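import Summits.BirchSwinnertonDyer.BirchSwinnertonDyer.Theorems.GenusKolyvaginAtTwoPowDvdShaCardAtTwoRTRelaxedSelmerGenusBudgetNegDisc
import HarnessLib

/-!
# Route `GenusKolyvaginAtTwo`, LINE 18 / LINE 19 (L_T stmt-BirchSwinnertonDyer-23242, L⁺_T stmt-23379), stub 3a‴
# `stub_twinLadderGenus`: the genus budget AT THE LEVEL OF `Ш` — the TORSOR-level relaxed group `res⁻¹(Ш(E_K/K))` of the
# ladder count contains `Ш(E/ℚ)` with index `≤ ∏_{p ∣ d_K} #E(ℚ_p)[2] = 2^{ord₂ C(Wd)}`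

Seat `bsd-line-gk2-p3` g18 (cell `bsd-f1-sign2`), `--supports stmt-BirchSwinnertonDyer-23242` (helper; closes nothing).
THEOREMS ONLY (no definition, no named fact, no `sorry`); BSD is not proved by any of this.

WHY.  The abstract ladder count of this seat (`…RTLadderCount{,Twin}`: `2·M₀ ≤ v₂ g₁ + v₂ g₂ + β₁ + β₂`, parity refund
`+ 2⌊βᵢ/2⌋`) runs in finite groups `Aᵢ` CONTAINING the Tate–Shafarevich groups over `ℚ` in which McCallum's descended
classes `d_M(n)` live: classes of `H¹(ℚ, E)` whose restriction to the Heegner field lies in `Ш(E_K/K)`.  The genus losses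
`βᵢ` are the indices `[Aᵢ : Ш]`.  g17 proved the budget at the SELMER level (`H¹(ℚ, E[n])`,
`relIndex_selmerGroup_relaxed_le_prod_natCard_twoTorsion`); this file proves it at the torsor level `H¹(ℚ, E)`, where
`Ш` itself lives — the currency of the count:

* §1 local, torsor level: `relIndex_localRestrictionKer_le_natCard_twoTorsion_of_dvd_discr`,
  `relIndex_localRestrictionKer_ne_zero` (at an odd ramified `p ∣ d_K` the classes dying in `H¹(K_𝔭, E)` contain those dying in
  `H¹(ℚ_p, E)` with FINITE index `≤ #W_{p,K} ≤ #E(ℚ_p)[2]`), `mem_localRestrictionKer_adicCompletion_of_resBaseChange_mem_sha`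
  (the `K`-local conditions of a class with `res c ∈ Ш(E_K)`), `localRestrictionKer_adicCompletion_eq_of_not_dvd_discr_of_imp`
  (off `d_K` the `K_w`- and `ℚ_p`-conditions agree: split, or unramified good).
* §2 `sha_le_comap_resBaseChange_sha_inf`, **`relIndex_sha_relaxed_le_prod_natCard_twoTorsion`**:
  `Ш(E/ℚ) ≤ res⁻¹(Ш(E_K/K)) ⊓ ⨅_∞(ℝ-condition)` with index `≤ ∏_{p ∣ d_K} #E(ℚ_p)[2]` (`[K:ℚ] = 2`, `d_K` odd, good reduction
  at the non-split `p ∤ d_K`).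
* §3 the LINE 18 frame: `_of_heegner`; on `Δ < 0` the real condition is automatic
  (`comap_resBaseChange_sha_inf_iInf_eq_of_Δ_neg`), so **`relIndex_sha_comap_resBaseChange_le_two_pow_padicValNat_tamagawaProduct_twin_of_Δ_neg`:
  `[res⁻¹(Ш(W_K/K)) : Ш(W/ℚ)] ≤ 2^{ord₂ C(Wd)}`** for `W` globally minimal with `C(W)` odd and `Wd` any model of the Heegner
  twist — the exponent of `stub_twinLadderGenus`.  Together with the count: per side `βᵢ ≤ ord₂ C(Wd)`, and by the parity
  refund 3a‴ holds on `ord₂ C(Wd) = 1` as soon as the families exist.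

References: [Kramer1981] §2 Prop. 3, Thm. 1; [Matsuno2009] §3, Prop. 3.2; [MazurRubin2010] Prop. 3.3; [GrossLMS1991] §1,
§6; [MilneADT2006] I Prop. 3.8, I.§6; [SilvermanAEC2009] X.§4.
-/

set_option autoImplicit false
-- the Theorems namespace of this sub repeats the summit name by design (D-0017 nested layout)
set_option linter.dupNamespace false

noncomputable section

open scoped Classical

namespace Summit.BirchSwinnertonDyer.BirchSwinnertonDyer.Theorems.GenusExact.PlusDescent

open WeierstrassCurve NumberField IsDedekindDomain Rat.HeightOneSpectrum Literature.NumberTheory.EllipticCurves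
  Literature.Barriers.BirchSwinnertonDyer

/-! ## §1 Local conditions at the torsor level -/

section Local

variable (E : WeierstrassCurve ℚ) [E.IsElliptic] (K : Type) [Field K] [NumberField K]

/-- **Torsor-level FINITE index at a quadratic place `w ∣ v ∤ 2`**: `[ker(H¹(ℚ,E) → H¹(K_w,E)) : ker(H¹(ℚ,E) → H¹(ℚ_v,E))]`
is non-zero (the quotient embeds into Matsuno's finite `W_{v,K}`; port of `relIndex_selmerLocalKer_ne_zero`).
[cite: Kramer1981, §2 Prop. 3] [cite: Matsuno2009, §3 (p. 451, W_{v,K}) and Prop. 3.2] -/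
theorem relIndex_localRestrictionKer_ne_zero (v : HeightOneSpectrum (𝓞 ℚ)) (w : HeightOneSpectrum (𝓞 K))
    [w.asIdeal.LiesOver v.asIdeal]
    (h2 : letI : Algebra (v.adicCompletion ℚ) (w.adicCompletion K) :=
        (Literature.NumberTheory.EllipticCurves.adicCompletionMap (K := ℚ) K v w).toAlgebra
      Module.finrank (v.adicCompletion ℚ) (w.adicCompletion K) = 2)
    (hw : ((2 : ℕ) : 𝓞 K) ∉ w.asIdeal) :
    (E.localRestrictionKer (v.adicCompletion ℚ)).relIndex (E.localRestrictionKer (w.adicCompletion K)) ≠ 0 := by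
  letI : Algebra (v.adicCompletion ℚ) (w.adicCompletion K) :=
    (Literature.NumberTheory.EllipticCurves.adicCompletionMap (K := ℚ) K v w).toAlgebra
  haveI : IsScalarTower ℚ (v.adicCompletion ℚ) (w.adicCompletion K) :=
    IsScalarTower.of_algebraMap_eq fun x ↦
      (Literature.NumberTheory.EllipticCurves.adicCompletionMap_coe (K := ℚ) K v w x).symm
  obtain ⟨hfin, -⟩ := natCard_localKernel_le_natCard_twoTorsion E K v w h2 hw
  haveI := hfin
  set H : AddSubgroup E.galH1 := E.localRestrictionKer (w.adicCompletion K) with hH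
  set H' : AddSubgroup E.galH1 := E.localRestrictionKer (v.adicCompletion ℚ) with hH'
  let f : E.galH1 →+ (E.baseChange (v.adicCompletion ℚ)).galH1 := resBaseChange E (v.adicCompletion ℚ)
  have hV : ∀ c ∈ H, f c ∈ Matsuno2009.localKernel E K v w := by
    intro c hc
    exact (mem_localRestrictionKer_iff_resBaseChange_mem E (L := v.adicCompletion ℚ)
      (E' := w.adicCompletion K) _).mp hc
  let g : H →+ Matsuno2009.localKernel E K v w := AddMonoidHom.codRestrict (f.comp H.subtype) _ fun c ↦ hV c c.2
  have hker : g.ker = H'.addSubgroupOf H := by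
    ext c
    rw [AddMonoidHom.mem_ker, AddSubgroup.mem_addSubgroupOf, hH', ← mem_ker_resBaseChange_iff]
    constructor
    · intro h; exact congrArg Subtype.val h
    · intro h; exact Subtype.ext h
  rw [AddSubgroup.relIndex, ← hker, AddSubgroup.index_ker]
  exact Nat.card_pos.ne'

variable {K} in
/-- **Torsor-level cost at an odd ramified `p ∣ d_K`**: `[K_w-condition : ℚ_p-condition] ≤ #E(ℚ_p)[2]` on `H¹(ℚ, E)`, and the
index is non-zero (`[K : ℚ] = 2`; binders discharged as in `relIndex_selmerLocalKer_le_natCard_twoTorsion_of_dvd_discr`).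
[cite: Kramer1981, §2 Prop. 3] [cite: Matsuno2009, §3 and Prop. 3.2] -/
theorem relIndex_localRestrictionKer_le_natCard_twoTorsion_of_dvd_discr (h2 : Module.finrank ℚ K = 2) {p : ℕ}
    (hp : p.Prime) (hp2 : p ≠ 2) (hpd : (p : ℤ) ∣ NumberField.discr K) (w : HeightOneSpectrum (𝓞 K))
    [w.asIdeal.LiesOver (Matsuno2009.primePlace p).asIdeal] :
    (E.localRestrictionKer ((Matsuno2009.primePlace p).adicCompletion ℚ)).relIndex
          (E.localRestrictionKer (w.adicCompletion K)) ≠ 0 ∧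
      (E.localRestrictionKer ((Matsuno2009.primePlace p).adicCompletion ℚ)).relIndex
          (E.localRestrictionKer (w.adicCompletion K)) ≤
        Nat.card {P : (E.baseChange ((Matsuno2009.primePlace p).adicCompletion ℚ)).toAffine.Point // 2 • P = 0} :=
  haveI := Fact.mk hp
  ⟨relIndex_localRestrictionKer_ne_zero E K (Matsuno2009.primePlace p) w
      (finrank_adicCompletion_primePlace_eq_two_of_dvd_discr w h2 hp hp2 hpd)
      (two_not_mem_of_liesOver_primePlace K w hp2),
    relIndex_localRestrictionKer_le_natCard_twoTorsion E K (Matsuno2009.primePlace p) w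
      (finrank_adicCompletion_primePlace_eq_two_of_dvd_discr w h2 hp hp2 hpd)
      (two_not_mem_of_liesOver_primePlace K w hp2)⟩

omit [E.IsElliptic] in
/-- **The `K`-local conditions of a class whose restriction lies in `Ш(E_K/K)`**: if `res c ∈ Ш(E_K/K)` then at every finite
place `w` of `K` the class `c ∈ H¹(ℚ, E)` dies in `H¹(K_w, E)` (local conditions correspond under restriction,
`mem_localRestrictionKer_iff_resBaseChange_mem`). [cite: MilneADT2006, Ch. I §6] [cite: SilvermanAEC2009, X.§4] -/
theorem mem_localRestrictionKer_adicCompletion_of_resBaseChange_mem_sha {c : E.galH1}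
    (hc : resBaseChange E K c ∈ (E.baseChange K).sha) (w : HeightOneSpectrum (𝓞 K)) :
    c ∈ E.localRestrictionKer (w.adicCompletion K) := by
  haveI : IsScalarTower ℚ K (w.adicCompletion K) := IsScalarTower.of_algebraMap_eq fun y ↦
    (IsScalarTower.algebraMap_apply ℚ K (w.adicCompletion K) y)
  rw [WeierstrassCurve.mem_sha_iff] at hc
  exact (mem_localRestrictionKer_iff_resBaseChange_mem E (L := K) (E' := w.adicCompletion K) _).mpr (hc.1 w)

variable {K} in
/-- **Off `d_K` the `K_w`-condition IS the `ℚ_p`-condition (torsor level)**: `[K : ℚ] = 2`, `d_K` odd, `p ∤ d_K`, good reduction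
at `p` unless `p` splits; then for `w ∣ p`, `ker(H¹(ℚ,E) → H¹(K_w,E)) = ker(H¹(ℚ,E) → H¹(ℚ_p,E))` (split: `W_{p,K} = 0`,
`localKernel_primePlace_eq_bot_of_ncard_primesOver_eq_two`; non-split: unramified good, Milne I.3.8,
`localRestrictionKer_adicCompletion_eq_of_not_dvd_discr`). [cite: MilneADT2006, Ch. I Prop. 3.8] [cite: Matsuno2009, §3 (p. 451)] -/
theorem localRestrictionKer_adicCompletion_eq_of_not_dvd_discr_of_imp (h2 : Module.finrank ℚ K = 2)
    (hodd : Odd (NumberField.discr K)) {p : ℕ} (hp : p.Prime) (hpd : ¬ (p : ℤ) ∣ NumberField.discr K)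
    (hgood : ((Ideal.span {(p : ℤ)}).primesOver (𝓞 K)).ncard ≠ 2 → E.HasGoodReductionAt (Matsuno2009.primePlace p))
    (w : HeightOneSpectrum (𝓞 K)) [w.asIdeal.LiesOver (Matsuno2009.primePlace p).asIdeal] :
    E.localRestrictionKer (w.adicCompletion K) = E.localRestrictionKer ((Matsuno2009.primePlace p).adicCompletion ℚ) := by
  by_cases hsplit : ((Ideal.span {(p : ℤ)}).primesOver (𝓞 K)).ncard = 2
  · exact localRestrictionKer_adicCompletion_eq_of_localKernel_eq_bot E K (Matsuno2009.primePlace p) w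
      (localKernel_primePlace_eq_bot_of_ncard_primesOver_eq_two E K w h2 hp hsplit)
  · exact localRestrictionKer_adicCompletion_eq_of_not_dvd_discr E K w h2 hodd hp hpd (hgood hsplit)

end Local

/-! ## §2 The genus budget at the level of `Ш` -/

section Budget

variable (E : WeierstrassCurve ℚ) [E.IsElliptic] (K : Type) [Field K] [NumberField K]

omit [E.IsElliptic] in
/-- `Ш(E/ℚ)` lies in the torsor-level relaxed group `res⁻¹(Ш(E_K/K)) ⊓ ⨅_∞ (ℝ-condition)` (`resBaseChange_mem_sha`).
[cite: MilneADT2006, Ch. I §6] -/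
theorem sha_le_comap_resBaseChange_sha_inf :
    E.sha ≤ ((E.baseChange K).sha).comap (resBaseChange E K) ⊓
      ⨅ w : InfinitePlace ℚ, E.localRestrictionKer w.Completion := by
  intro x hx
  refine ⟨AddSubgroup.mem_comap.mpr (resBaseChange_mem_sha E K hx), ?_⟩
  exact (AddSubgroup.mem_inf.mp hx).2

/-- **THE GENUS BUDGET AT THE LEVEL OF `Ш`.**  `E/ℚ` elliptic, `K` a quadratic field with odd `d_K` such that `E` has good
reduction at every non-split `p ∤ d_K` (the Heegner field: every bad prime splits).  Then the torsor-level relaxed group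
`res⁻¹(Ш(E_K/K)) ⊓ ⨅_∞ (ℝ-condition)` — the classes of `H¹(ℚ, E)` that are everywhere locally trivial after restriction to `K`
and at `ℝ` — contains `Ш(E/ℚ)` with index `≤ ∏_{p ∣ d_K} #E(ℚ_p)[2]` (`= 2^{Σ i_p}`).  Proof = g17's Selmer-level proof one floor
down: both groups are intersections of local kernels which agree off `d_K` (§1) and differ at `p ∣ d_K` by a subgroup of
Matsuno's `W_{p,K}`, `#W_{p,K} ≤ #E(ℚ_p)[2]`; `relIndex_inf_iInf_le_prod`.  This is the index `[A₁ : Ш]` (`β₁`) of the ladder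
count `two_mul_le_padicValNat_add_of_twinLadder`. [cite: Kramer1981, §2 Prop. 3 and Thm. 1] [cite: MazurRubin2010, Prop. 3.3]
[cite: Matsuno2009, Prop. 3.2] -/
theorem relIndex_sha_relaxed_le_prod_natCard_twoTorsion (h2 : Module.finrank ℚ K = 2) (hodd : Odd (NumberField.discr K))
    (hgood : ∀ p : ℕ, p.Prime → ¬ (p : ℤ) ∣ NumberField.discr K →
      ((Ideal.span {(p : ℤ)}).primesOver (𝓞 K)).ncard ≠ 2 → E.HasGoodReductionAt (Matsuno2009.primePlace p)) :
    (E.sha).relIndex (((E.baseChange K).sha).comap (resBaseChange E K) ⊓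
        ⨅ w : InfinitePlace ℚ, E.localRestrictionKer w.Completion) ≤
      ∏ p ∈ (NumberField.discr K).natAbs.primeFactors,
        Nat.card {P : (E.baseChange ((Matsuno2009.primePlace p).adicCompletion ℚ)).toAffine.Point // 2 • P = 0} := by
  set D : Finset ℕ := (NumberField.discr K).natAbs.primeFactors with hDdef
  have hD0 : (NumberField.discr K).natAbs ≠ 0 := Int.natAbs_ne_zero.mpr (NumberField.discr_ne_zero K)
  have hmemD : ∀ {p : ℕ}, p ∈ D ↔ p.Prime ∧ (p : ℤ) ∣ NumberField.discr K := by
    intro p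
    rw [hDdef, Nat.mem_primeFactors, Int.natCast_dvd]
    exact ⟨fun h ↦ ⟨h.1, h.2.1⟩, fun h ↦ ⟨h.1, h.2, hD0⟩⟩
  have hDodd : ∀ p : D, (p : ℕ) ≠ 2 := by
    rintro ⟨p, hp⟩ (h2' : p = 2)
    obtain ⟨-, hpd⟩ := hmemD.mp hp
    rw [h2'] at hpd
    obtain ⟨r, hr⟩ := hodd
    omega
  -- a place of `K` above every place of `ℚ`
  have hexw : ∀ v : HeightOneSpectrum (𝓞 ℚ), ∃ w : HeightOneSpectrum (𝓞 K), w.asIdeal.LiesOver v.asIdeal := by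
    intro v
    haveI := v.isMaximal
    obtain ⟨P, hPm, hP⟩ := Ideal.exists_maximal_ideal_liesOver_of_isIntegral (S := 𝓞 K) v.asIdeal
    exact ⟨⟨P, hPm.isPrime, Ideal.ne_bot_of_liesOver_of_ne_bot v.ne_bot P⟩, hP⟩
  choose wv hwv using hexw
  let wp : D → HeightOneSpectrum (𝓞 K) := fun p ↦ wv (Matsuno2009.primePlace p)
  have hwp : ∀ p : D, (wp p).asIdeal.LiesOver (Matsuno2009.primePlace (p : ℕ)).asIdeal := fun p ↦ hwv _
  -- the local conditions
  let H' : HeightOneSpectrum (𝓞 ℚ) → AddSubgroup E.galH1 := fun v ↦ E.localRestrictionKer (v.adicCompletion ℚ)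
  let Hs : D → AddSubgroup E.galH1 := fun p ↦ E.localRestrictionKer ((wp p).adicCompletion K)
  let H's : D → AddSubgroup E.galH1 := fun p ↦ H' (Matsuno2009.primePlace p)
  let Ainf : AddSubgroup E.galH1 := ⨅ w : InfinitePlace ℚ, E.localRestrictionKer w.Completion
  let C : AddSubgroup E.galH1 := (⨅ v : {v : HeightOneSpectrum (𝓞 ℚ) // (primesEquiv v : ℕ) ∉ D}, H' v) ⊓ Ainf
  set R : AddSubgroup E.galH1 := ((E.baseChange K).sha).comap (resBaseChange E K) ⊓ Ainf with hRdef
  -- (a) `C ⊓ ⨅ H's ≤ Ш`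
  have hS₀ : C ⊓ (⨅ p : D, H's p) ≤ E.sha := by
    intro x hx
    obtain ⟨⟨hxC, hxinf⟩, hxD⟩ := AddSubgroup.mem_inf.mp hx |>.imp AddSubgroup.mem_inf.mp id
    refine (WeierstrassCurve.mem_sha_iff E x).mpr ⟨fun v ↦ ?_, fun w ↦ AddSubgroup.mem_iInf.mp hxinf w⟩
    by_cases hv : (primesEquiv v : ℕ) ∈ D
    · have h := AddSubgroup.mem_iInf.mp hxD ⟨_, hv⟩
      change x ∈ E.localRestrictionKer ((Matsuno2009.primePlace (primesEquiv v : ℕ)).adicCompletion ℚ) at h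
      rwa [primePlace_primesEquiv] at h
    · exact AddSubgroup.mem_iInf.mp hxC ⟨v, hv⟩
  -- (b) `R ≤ C ⊓ ⨅ Hs`
  have hR : R ≤ C ⊓ (⨅ p : D, Hs p) := by
    intro x hx
    obtain ⟨hxK, hxinf⟩ := AddSubgroup.mem_inf.mp hx
    rw [AddSubgroup.mem_comap] at hxK
    refine AddSubgroup.mem_inf.mpr ⟨AddSubgroup.mem_inf.mpr ⟨AddSubgroup.mem_iInf.mpr fun v ↦ ?_, hxinf⟩,
      AddSubgroup.mem_iInf.mpr fun p ↦ ?_⟩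
    · -- off `d_K`: the `K_w`-condition (from `res x ∈ Ш(E_K)`) is the `ℚ_v`-condition
      obtain ⟨v, hv⟩ := v
      set p : ℕ := (primesEquiv v : ℕ) with hpdef
      have hp : p.Prime := (primesEquiv v).2
      have hpd : ¬ (p : ℤ) ∣ NumberField.discr K := fun h ↦ hv (hmemD.mpr ⟨hp, h⟩)
      change x ∈ E.localRestrictionKer (v.adicCompletion ℚ)
      rw [← primePlace_primesEquiv v]
      haveI := hwv (Matsuno2009.primePlace p)
      rw [← localRestrictionKer_adicCompletion_eq_of_not_dvd_discr_of_imp E h2 hodd hp hpd (hgood p hp hpd)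
        (wv (Matsuno2009.primePlace p))]
      exact mem_localRestrictionKer_adicCompletion_of_resBaseChange_mem_sha E K hxK (wv (Matsuno2009.primePlace p))
    · exact mem_localRestrictionKer_adicCompletion_of_resBaseChange_mem_sha E K hxK (wp p)
  -- (c) the indices at `p ∣ d_K`
  have hloc : ∀ p : D, (H's p).relIndex (Hs p) ≠ 0 ∧ (H's p).relIndex (Hs p) ≤
      Nat.card {P : (E.baseChange ((Matsuno2009.primePlace (p : ℕ)).adicCompletion ℚ)).toAffine.Point // 2 • P = 0} := by
    intro p
    haveI := hwp p
    obtain ⟨hp, hpd⟩ := hmemD.mp p.2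
    exact relIndex_localRestrictionKer_le_natCard_twoTorsion_of_dvd_discr E h2 hp (hDodd p) hpd (wp p)
  -- (d) assembly
  have hne : (C ⊓ ⨅ p : D, H's p).relIndex (C ⊓ ⨅ p : D, Hs p) ≠ 0 :=
    relIndex_inf_iInf_ne_zero C H's Hs fun p ↦ (hloc p).1
  have hne' : (E.sha).relIndex (C ⊓ ⨅ p : D, Hs p) ≠ 0 :=
    ne_zero_of_dvd_ne_zero hne (AddSubgroup.relIndex_dvd_of_le_left _ hS₀)
  calc (E.sha).relIndex R
      ≤ (E.sha).relIndex (C ⊓ ⨅ p : D, Hs p) := AddSubgroup.relIndex_le_of_le_right hR hne'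
    _ ≤ (C ⊓ ⨅ p : D, H's p).relIndex (C ⊓ ⨅ p : D, Hs p) := AddSubgroup.relIndex_le_of_le_left hS₀ hne
    _ ≤ ∏ p : D, (H's p).relIndex (Hs p) := relIndex_inf_iInf_le_prod C H's Hs fun p ↦ (hloc p).1
    _ ≤ ∏ p : D, Nat.card {P : (E.baseChange ((Matsuno2009.primePlace (p : ℕ)).adicCompletion ℚ)).toAffine.Point //
          2 • P = 0} := Finset.prod_le_prod' fun p _ ↦ (hloc p).2
    _ = ∏ p ∈ D, Nat.card {P : (E.baseChange ((Matsuno2009.primePlace p).adicCompletion ℚ)).toAffine.Point //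
          2 • P = 0} :=
        Finset.prod_coe_sort D (f := fun p : ℕ ↦
          Nat.card {P : (E.baseChange ((Matsuno2009.primePlace p).adicCompletion ℚ)).toAffine.Point // 2 • P = 0})

/-- **The relaxed group has finite, non-zero index over `Ш(E/ℚ)`** under the same hypotheses (needed to turn `≤` bounds on the
index into cardinality statements). [cite: Kramer1981, §2 Prop. 3] [cite: Matsuno2009, Prop. 3.2] -/
theorem relIndex_sha_relaxed_ne_zero (h2 : Module.finrank ℚ K = 2) (hodd : Odd (NumberField.discr K))
    (hgood : ∀ p : ℕ, p.Prime → ¬ (p : ℤ) ∣ NumberField.discr K →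
      ((Ideal.span {(p : ℤ)}).primesOver (𝓞 K)).ncard ≠ 2 → E.HasGoodReductionAt (Matsuno2009.primePlace p)) :
    (E.sha).relIndex (((E.baseChange K).sha).comap (resBaseChange E K) ⊓
        ⨅ w : InfinitePlace ℚ, E.localRestrictionKer w.Completion) ≠ 0 := by
  -- same sandwich as above: `Ш ≥ C ⊓ ⨅ H's` of finite index in `C ⊓ ⨅ Hs ≥ R`
  set D : Finset ℕ := (NumberField.discr K).natAbs.primeFactors with hDdef
  have hD0 : (NumberField.discr K).natAbs ≠ 0 := Int.natAbs_ne_zero.mpr (NumberField.discr_ne_zero K)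
  have hmemD : ∀ {p : ℕ}, p ∈ D ↔ p.Prime ∧ (p : ℤ) ∣ NumberField.discr K := by
    intro p
    rw [hDdef, Nat.mem_primeFactors, Int.natCast_dvd]
    exact ⟨fun h ↦ ⟨h.1, h.2.1⟩, fun h ↦ ⟨h.1, h.2, hD0⟩⟩
  have hDodd : ∀ p : D, (p : ℕ) ≠ 2 := by
    rintro ⟨p, hp⟩ (h2' : p = 2)
    obtain ⟨-, hpd⟩ := hmemD.mp hp
    rw [h2'] at hpd
    obtain ⟨r, hr⟩ := hodd
    omega
  have hexw : ∀ v : HeightOneSpectrum (𝓞 ℚ), ∃ w : HeightOneSpectrum (𝓞 K), w.asIdeal.LiesOver v.asIdeal := by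
    intro v
    haveI := v.isMaximal
    obtain ⟨P, hPm, hP⟩ := Ideal.exists_maximal_ideal_liesOver_of_isIntegral (S := 𝓞 K) v.asIdeal
    exact ⟨⟨P, hPm.isPrime, Ideal.ne_bot_of_liesOver_of_ne_bot v.ne_bot P⟩, hP⟩
  choose wv hwv using hexw
  let wp : D → HeightOneSpectrum (𝓞 K) := fun p ↦ wv (Matsuno2009.primePlace p)
  have hwp : ∀ p : D, (wp p).asIdeal.LiesOver (Matsuno2009.primePlace (p : ℕ)).asIdeal := fun p ↦ hwv _
  let H' : HeightOneSpectrum (𝓞 ℚ) → AddSubgroup E.galH1 := fun v ↦ E.localRestrictionKer (v.adicCompletion ℚ)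
  let Hs : D → AddSubgroup E.galH1 := fun p ↦ E.localRestrictionKer ((wp p).adicCompletion K)
  let H's : D → AddSubgroup E.galH1 := fun p ↦ H' (Matsuno2009.primePlace p)
  let Ainf : AddSubgroup E.galH1 := ⨅ w : InfinitePlace ℚ, E.localRestrictionKer w.Completion
  let C : AddSubgroup E.galH1 := (⨅ v : {v : HeightOneSpectrum (𝓞 ℚ) // (primesEquiv v : ℕ) ∉ D}, H' v) ⊓ Ainf
  set R : AddSubgroup E.galH1 := ((E.baseChange K).sha).comap (resBaseChange E K) ⊓ Ainf with hRdef
  have hS₀ : C ⊓ (⨅ p : D, H's p) ≤ E.sha := by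
    intro x hx
    obtain ⟨⟨hxC, hxinf⟩, hxD⟩ := AddSubgroup.mem_inf.mp hx |>.imp AddSubgroup.mem_inf.mp id
    refine (WeierstrassCurve.mem_sha_iff E x).mpr ⟨fun v ↦ ?_, fun w ↦ AddSubgroup.mem_iInf.mp hxinf w⟩
    by_cases hv : (primesEquiv v : ℕ) ∈ D
    · have h := AddSubgroup.mem_iInf.mp hxD ⟨_, hv⟩
      change x ∈ E.localRestrictionKer ((Matsuno2009.primePlace (primesEquiv v : ℕ)).adicCompletion ℚ) at h
      rwa [primePlace_primesEquiv] at h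
    · exact AddSubgroup.mem_iInf.mp hxC ⟨v, hv⟩
  have hR : R ≤ C ⊓ (⨅ p : D, Hs p) := by
    intro x hx
    obtain ⟨hxK, hxinf⟩ := AddSubgroup.mem_inf.mp hx
    rw [AddSubgroup.mem_comap] at hxK
    refine AddSubgroup.mem_inf.mpr ⟨AddSubgroup.mem_inf.mpr ⟨AddSubgroup.mem_iInf.mpr fun v ↦ ?_, hxinf⟩,
      AddSubgroup.mem_iInf.mpr fun p ↦ ?_⟩
    · obtain ⟨v, hv⟩ := v
      set p : ℕ := (primesEquiv v : ℕ) with hpdef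
      have hp : p.Prime := (primesEquiv v).2
      have hpd : ¬ (p : ℤ) ∣ NumberField.discr K := fun h ↦ hv (hmemD.mpr ⟨hp, h⟩)
      change x ∈ E.localRestrictionKer (v.adicCompletion ℚ)
      rw [← primePlace_primesEquiv v]
      haveI := hwv (Matsuno2009.primePlace p)
      rw [← localRestrictionKer_adicCompletion_eq_of_not_dvd_discr_of_imp E h2 hodd hp hpd (hgood p hp hpd)
        (wv (Matsuno2009.primePlace p))]
      exact mem_localRestrictionKer_adicCompletion_of_resBaseChange_mem_sha E K hxK (wv (Matsuno2009.primePlace p))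
    · exact mem_localRestrictionKer_adicCompletion_of_resBaseChange_mem_sha E K hxK (wp p)
  have hloc : ∀ p : D, (H's p).relIndex (Hs p) ≠ 0 := by
    intro p
    haveI := hwp p
    obtain ⟨hp, hpd⟩ := hmemD.mp p.2
    exact (relIndex_localRestrictionKer_le_natCard_twoTorsion_of_dvd_discr E h2 hp (hDodd p) hpd (wp p)).1
  have hne : (C ⊓ ⨅ p : D, H's p).relIndex (C ⊓ ⨅ p : D, Hs p) ≠ 0 := relIndex_inf_iInf_ne_zero C H's Hs hloc
  have hne' : (E.sha).relIndex (C ⊓ ⨅ p : D, Hs p) ≠ 0 :=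
    ne_zero_of_dvd_ne_zero hne (AddSubgroup.relIndex_dvd_of_le_left _ hS₀)
  exact fun h0 ↦ hne' (AddSubgroup.relIndex_eq_zero_of_le_right hR h0)

end Budget

/-! ## §3 The LINE 18 frame: Heegner field, `Δ < 0`, the exponent `ord₂ C(Wd)` -/

section Heegner

variable (W : WeierstrassCurve ℚ) [W.IsElliptic] (K : Type) [Field K] [NumberField K]

/-- **The `Ш`-level genus budget for the Heegner field** (binders of the LINE 18/19 skeletons): `W/ℚ` elliptic, `K` imaginary
quadratic with odd `d_K` and the Heegner hypothesis for `N_W`; then `[res⁻¹(Ш(W_K/K)) ⊓ ⨅_∞ : Ш(W/ℚ)] ≤ ∏_{p ∣ d_K} #E(ℚ_p)[2]`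
and the index is non-zero. [cite: Kramer1981, §2 Prop. 3 and Thm. 1] [cite: GrossLMS1991, §1] -/
theorem relIndex_sha_relaxed_le_prod_natCard_twoTorsion_of_heegner (hIQ : IsImaginaryQuadratic K)
    (hodd : Odd (NumberField.discr K)) (hHe : SatisfiesHeegnerHypothesis (W.conductorNorm ℤ) K) :
    (W.sha).relIndex (((W.baseChange K).sha).comap (resBaseChange W K) ⊓
          ⨅ w : InfinitePlace ℚ, W.localRestrictionKer w.Completion) ≠ 0 ∧
      (W.sha).relIndex (((W.baseChange K).sha).comap (resBaseChange W K) ⊓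
          ⨅ w : InfinitePlace ℚ, W.localRestrictionKer w.Completion) ≤
        ∏ p ∈ (NumberField.discr K).natAbs.primeFactors,
          Nat.card {P : (W.baseChange ((Matsuno2009.primePlace p).adicCompletion ℚ)).toAffine.Point // 2 • P = 0} :=
  ⟨relIndex_sha_relaxed_ne_zero W K hIQ.1 hodd
      fun _ hp _ hns ↦ hasGoodReductionAt_primePlace_of_ncard_ne_two W K hHe hp hns,
    relIndex_sha_relaxed_le_prod_natCard_twoTorsion W K hIQ.1 hodd
      fun _ hp _ hns ↦ hasGoodReductionAt_primePlace_of_ncard_ne_two W K hHe hp hns⟩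

/-- **On `Δ < 0` the archimedean condition over `ℚ` is automatic at the torsor level**: `⨅_∞ ker(H¹(ℚ,E) → H¹(ℚ_∞,E)) = ⊤`
(`H¹(ℝ, E) = 0` when complex conjugation moves a `2`-torsion point, `localRestrictionKer_infinitePlace_eq_top_of_Δ_neg`).
[cite: GrossLMS1991, §6 (proof of Prop. 6.2 (1))] -/
theorem iInf_localRestrictionKer_infinitePlace_eq_top_of_Δ_neg (hΔ : W.Δ < 0) :
    (⨅ w : InfinitePlace ℚ, W.localRestrictionKer w.Completion) = ⊤ :=
  iInf_eq_top.mpr fun w ↦ ArchVanishing.localRestrictionKer_infinitePlace_eq_top_of_Δ_neg W w hΔ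

/-- **`Δ < 0`: the torsor-level relaxed group is the bare preimage `res⁻¹(Ш(W_K/K))`.** [cite: GrossLMS1991, §6] -/
theorem comap_resBaseChange_sha_inf_iInf_eq_of_Δ_neg (hΔ : W.Δ < 0) :
    ((W.baseChange K).sha).comap (resBaseChange W K) ⊓ (⨅ w : InfinitePlace ℚ, W.localRestrictionKer w.Completion) =
      ((W.baseChange K).sha).comap (resBaseChange W K) := by
  rw [iInf_localRestrictionKer_infinitePlace_eq_top_of_Δ_neg W hΔ, inf_top_eq]

/-- **THE `Ш`-LEVEL GENUS BUDGET ON `Δ < 0` IN THE CURRENCY OF 3a‴: `[res⁻¹(Ш(W_K/K)) : Ш(W/ℚ)] ≤ 2^{ord₂ C(Wd)}`**, the index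
finite, for `W/ℚ` globally minimal elliptic with `Δ_W < 0` and `C(W)` odd, `K` imaginary quadratic with odd `d_K` and the Heegner
hypothesis for `N_W`, and `Wd = Cd • W^{(d_K)}` any model of the twin (`∏_{q ∣ d_K} #E(ℚ_q)[2] = ∏ (#roots ψ mod q + 1) = 2^{ord₂ C(Wd)}`,
gk2-p3 g17's `prod_ncard_roots_add_one_eq_two_pow_padicValNat_tamagawaProduct_twin`).  With the ladder count this bounds the
(+)-side loss `β₁ ≤ ord₂ C(Wd)`; the same theorem for the twin `Wd` (whose Heegner twist is `W` again) bounds `β₂`.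
[cite: Kramer1981, §2 Prop. 3 and Thm. 1] [cite: BoxerDiao2010, proof of Prop. 4.1 (p. 1977)] -/
theorem relIndex_sha_comap_resBaseChange_le_two_pow_padicValNat_tamagawaProduct_twin_of_Δ_neg [W.IsGloballyMinimal]
    (hΔ : W.Δ < 0) (hIQ : IsImaginaryQuadratic K) (hodd : Odd (NumberField.discr K))
    (hHe : SatisfiesHeegnerHypothesis (W.conductorNorm ℤ) K) (hT : Odd W.tamagawaProduct)
    {Wd : WeierstrassCurve ℚ} [Wd.IsElliptic] (Cd : VariableChange ℚ)
    (hWd : Cd • W.quadraticTwist (NumberField.discr K : ℚ) = Wd) :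
    (W.sha).relIndex (((W.baseChange K).sha).comap (resBaseChange W K)) ≠ 0 ∧
      (W.sha).relIndex (((W.baseChange K).sha).comap (resBaseChange W K)) ≤ 2 ^ padicValNat 2 Wd.tamagawaProduct := by
  obtain ⟨hne, hle⟩ := relIndex_sha_relaxed_le_prod_natCard_twoTorsion_of_heegner W K hIQ hodd hHe
  rw [comap_resBaseChange_sha_inf_iInf_eq_of_Δ_neg W K hΔ] at hne hle
  refine ⟨hne, hle.trans_eq ?_⟩
  rw [← prod_ncard_roots_add_one_eq_two_pow_padicValNat_tamagawaProduct_twin W hIQ hodd hHe hT Cd hWd]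
  refine Finset.prod_congr rfl fun p hp ↦ ?_
  have hD0 : (NumberField.discr K).natAbs ≠ 0 := Int.natAbs_ne_zero.mpr (NumberField.discr_ne_zero K)
  obtain ⟨hpr, hpdvd, -⟩ := Nat.mem_primeFactors.mp hp
  have hpd : (p : ℤ) ∣ NumberField.discr K := Int.natCast_dvd.mpr hpdvd
  have hp2 : p ≠ 2 := by
    rintro rfl
    obtain ⟨r, hr⟩ := hodd
    omega
  haveI := Fact.mk hpr
  rw [natCard_twoTorsion_adicCompletion_eq_padic W (Matsuno2009.primePlace p) (Matsuno2009.natCast_mem_primePlace hpr)]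
  exact GenusKolyTwin.natCard_twoTorsion_padic_eq W hp2
    (not_dvd_minimalDiscriminantInt_of_dvd_discr_of_heegner W K hIQ.1 hHe hpr hp2 hpd)

end Heegner

end Summit.BirchSwinnertonDyer.BirchSwinnertonDyer.Theorems.GenusExact.PlusDescent

end
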